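/-
Copyright: statement-level skeleton of a published paper (lit-balaban cell, Phase-2 proof seat p13, gen 7). No proof
claims beyond what the kernel checks below.
-/
import Literature.MathematicalPhysics.QuantumFieldTheory.BalabanImbrieJaffe1984to88.BIJ88RandomWalk578

/-!
# `BalabanImbrieJaffe1984to88.BIJ88Delta5711` — T. Bałaban, J. Imbrie, A. Jaffe, *Effective action and cluster properties
of the abelian Higgs model*, Commun. Math. Phys. **114** (1988) 257–315 [BalabanImbrieJaffe1988]: Sect. 5.7, p. 293 —
THE PIECES `Δ_j(X)` OF THE INVERSE COVARIANCE (5.7.11): *"We insert this expansion into C^{(j)−1} to obtain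
C^{(j)}(u_{k+1})^{−1} = C^{(j)}(Λ̄₂^{(m)},u_{k+1})^{−1} + Σ_X Δ_j(X), … |Δ_j(X, x₁, x₂)| ≦ e^{−cr(e_j)|X|}, = 0 if x₁ or
x₂ ∉ X"* — the KERNEL form of the expansion, the SUPPORT CLAUSE and the BOUND, PROVED for the random walk expansion
(5.7.8) of [6] = [Balaban1983RegularityDecay] read as kernels (`BIJ88RandomWalk578`, same seat), together with *"We only
need to look at this operator in Λ̄₃^{(m)}"* for the middle term of the p. 293 rewriting

statement-level skeleton of published theorems with citation tags; proofs where landed; nothing here is a claim about the Yang–Mills mass gap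

PDF held: `paper:balaban1988-cmp114-bij-abelian-higgs-effective-action` (journal page = PDF page + 256); p. 293 [PDF 37]
read as an IMAGE (CCITT render `pages/original-p037-x2.png`; copy `HOME/lit-balaban-p13/pages/`).

CITATION HEADER (lean-in-tree rule).  Part of the lit-balaban TYPED SKELETON (HOME `run/shared/lean/pub/lit-balaban/`):
WHAT IS REPRODUCED = row **C2.Eq5.7.10-5.7.12** of `HOME/lit-balaban-r16/ROWS-C2-part2.md`, the where-clause of (5.7.11)
(r16 v2.25: *"the bounds |Δ_j(X)| ≤ e^{−cr(e_j)|X|} and (5.7.12) stay absent"*); unit `lit-balaban-p13` (gen 7), owner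
r16, referee ref-5.  The RING ALGEBRA of the same page — `C^{−1} = C̄^{−1} + D ⟹ C = C̄ − C̄DC` and the Neumann
expansion `Σ_p C[DC]^p` — is p36's `BIJ88Resolvent5711` and is NOT repeated; this file supplies what that file lists as
*"NOT here: the bounds |Δ_j(X,x₁,x₂)| ≤ e^{−cr(e_j)|X|}, the support clause"*, for rectangular averaging kernels
`Q_j : T₁ × T_η`, `Q_j^* : T_η × T₁`.  Built BY NAME on `BIJ88RandomWalk578` (`display293_G`, `gX_support`, `abs_gX_le`,
`gLoc_congr`), `BIJ88RandomWalk242` (`cLoc`, `cX`, `memX`), p36's `BIJ88Ineq246Walks.cX_empty`; nothing restated.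

## The print (p. 293 [PDF 37], verbatim)

*"We need to replace the propagators G_{j,loc}(u_{k+1}), G_j(□,u_{k+1}) by G_j(Λ̄₂^{(m)},u_{k+1}). They appear in the
expansion of Δ_{j,loc}(u_{k+1}) and indirectly in C^{(j)}(u_{k+1}). We write G_{j,loc}(u_{k+1}) = G_j(Λ̄₂^{(m)},u_{k+1})
+ (G_{j,loc}(u_{k+1}) − G_{j,loc}(Λ̄₂^{(m)},u_{k+1})) + Σ_X G_j(Λ̄₂^{(m)},X,u_{k+1}), and similarly for G_{j,loc}(□,u_{k+1}).
We only need to look at this operator in Λ̄₃^{(m)}. There a random walk expansion on the j-th scale will yield the usual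
regularity bounds on the second term on the right with an extra factor e^{−cr(e_j)}. We insert this expansion into
C^{(j)−1} to obtain C^{(j)}_{B_{m−j}(Λ₃^{(m)})}(u_{k+1})^{−1} = C^{(j)}_{B_{m−j}(Λ₃^{(m)})}(Λ̄₂^{(m)},u_{k+1})^{−1} + Σ_X Δ_j(X),
where C^{(j)}_{B_{m−j}(Λ₃^{(m)})}(Λ̄₂^{(m)},u_{k+1})^{−1} = a_jI − a_j²Q_j(u_{k+1})G_j(Λ̄₂^{(m)},u_{k+1})Q_j^*(u_{k+1}) +
aL^{−2}P(u_{k+1}), (5.7.11)   |Δ_j(X, x₁, x₂)| ≦ e^{−cr(e_j)|X|}, = 0 if x₁ or x₂ ∉ X."*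

## The typing (model instance, READING declared)

Carriers: fine sites `σ` (the lattice of `G_j`), block labels `ι` and cubes `κ` of [6]'s expansion as in
`BIJ88RandomWalk578` (letters `a_j = h_jG(□_j)h_j`, `b_j = K_jG(□_j)h_j` read as kernels `a b : ι → Matrix σ σ ℝ`, block
supports `blk`, label-to-site distance `ldist`, radius `ρ`, cube map `cubeOf`, cube adjacency `cadj`); COARSE sites `τ`
(the unit lattice `T^{(j)}_1` on which `C^{(j)}` acts); `Q : Matrix τ σ ℝ`, `Qs : Matrix σ τ ℝ` the averaging kernels
`Q_j(u_{k+1})`, `Q_j^*(u_{k+1})`; `aj = a_j`; `P' : Matrix τ τ ℝ` the term `aL^{−2}P(u_{k+1})`.  With the (5.7.8) parts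
`G_loc = cLoc …`, `G_X = cX … X` of `G = G_j(Λ̄₂^{(m)},u_{k+1})` (`BIJ88RandomWalk578.eq578`) and ANY kernel `G_{j,loc}`
(the print's `G_{j,loc}(u_{k+1})`), the p. 293 rewriting holds with the sign of `Σ_X` CORRECTED
(`BIJ88RandomWalk578.display293_G`; GAPS G-C2-p13-g7-1, owner concurs), so that

  `a_j·1 − a_j²·Q G_{j,loc} Q^* + P' = [a_j·1 − a_j²·Q G Q^* + P'] − a_j²·Q (G_{j,loc} − G_loc) Q^* + Σ_X a_j²·Q G_X Q^*`

(**`inv5711_kernel`**; the generic bookkeeping is `inv_expand_kernel`).  READING: `Δ_j(X) := a_j²·Q G_j(Λ̄₂,X) Q^*`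
(`Matrix τ τ ℝ`; the print absorbs into `Σ_X Δ_j(X)` also the `X`-pieces of the middle term, which is kept separate
here), and *"x ∈ X"* for a coarse site is ANY membership `cmem x X` compatible with the supports of `Q`, `Q^*`
(`Q(y,x) ≠ 0`, `x` in a block inside `X` ⟹ `cmem y X`; e.g. "the averaging block of `y` meets a block inside `X`").
* **`delta_support`** — *"= 0 if x₁ or x₂ ∉ X"*: `Δ_j(X)(y₁,y₂) = 0` unless `cmem y₁ X ∧ cmem y₂ X`, from the support
  clause of (5.7.8) (`gX_support`) through the sandwich `Q · Q^*` (`sandwich_apply_eq_zero`).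
* **`abs_delta_le`** — *"|Δ_j(X, x₁, x₂)| ≦ e^{−cr(e_j)|X|}"* with the constant displayed:
  `|Δ_j(X)(y₁,y₂)| ≤ a_j²·q·q^*·exp(−(δ/(32K²M))·rek·|X|)`, `q`, `q^*` row/column `ℓ¹` sizes of `Q`, `Q^*`, the
  exponential being the (5.7.8) factor of `BIJ88RandomWalk578.abs_gX_le` (its label/cube geometry hypotheses verbatim;
  `rek` = the cube side in label units, here the print's `r(e_j)`); **`abs_delta_le_printed`** — the constant-free
  printed form `≤ exp(−(c/2)|X|)`, `c = (δ/(32K²M))·rek`, once `a_j²qq^* ≤ e^{c/2}` (`X = ∅` by `cX_empty`).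
* **`middle_apply_eq_zero`** — *"We only need to look at this operator in Λ̄₃^{(m)}"*: the middle term
  `a_j²·Q (G_{j,loc}(u) − G_{j,loc}(Λ̄₂,u)) Q^*` VANISHES at `(y₁,y₂)` as soon as the two letter families (whole
  lattice / region `Λ̄₂`) coincide at every label within `ρ` of the fine sites averaged into `y₁` (`gLoc_congr`:
  *"G_{j,loc} is independent of Ω"* far from `Ω^c`) — in the `ρ`-neighbourhood model of `G_{j,loc}` this is exact
  vanishing on `Λ̄₃` when `dist(Λ̄₃, Λ̄₂^c) > ρ + O(M)`; the print's cube model `□(x₁,x₂)` gives there a factor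
  `e^{−cr(e_j)}` instead (HONEST SCOPE: that factor, the `X`-localization of the middle term and (5.7.12) are not here).

Generic kernel lemmas (any `Q`, `K`, `Q^*`): `sandwich_apply_eq_zero`, `abs_sandwich_apply_le`, `delta_support_of`,
`abs_delta_le_of`.  Theorems only; no definitions, no `Prop` facts; axioms standard.
-/

namespace Literature.MathematicalPhysics.QuantumFieldTheory.BalabanImbrieJaffe1984to88.BIJ88Delta5711

open Finset
open Literature.MathematicalPhysics.QuantumFieldTheory.Balaban1983to89.B4RandomWalk213
open BIJ88RandomWalk242 BIJ88RandomWalk578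
open scoped Matrix Matrix.Norms.Operator

variable {ι σ τ κ : Type*} [Fintype ι] [DecidableEq ι] [Fintype σ] [DecidableEq σ] [Fintype τ] [DecidableEq τ]
  [Fintype κ] [DecidableEq κ]

/-! ## §1 Sandwich kernels `Q K Q^*`: entries, support, size -/

section Sandwich

omit [Fintype ι] [DecidableEq ι] [DecidableEq σ] [Fintype τ] [DecidableEq τ] [Fintype κ] [DecidableEq κ] in
/-- support of a sandwich kernel: `(Q K Q^*)(y₁,y₂) = 0` when `K(x₁,x₂) = 0` for all fine sites `x₁` averaged into `y₁`
(`Q(y₁,x₁) ≠ 0`) and `x₂` averaged into `y₂` (`Q^*(x₂,y₂) ≠ 0`). [cite: BalabanImbrieJaffe1988, (5.7.11) p.293] -/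
theorem sandwich_apply_eq_zero {Q : Matrix τ σ ℝ} {K : Matrix σ σ ℝ} {Qs : Matrix σ τ ℝ} {y₁ y₂ : τ}
    (h : ∀ x₁ x₂, Q y₁ x₁ ≠ 0 → Qs x₂ y₂ ≠ 0 → K x₁ x₂ = 0) : (Q * K * Qs) y₁ y₂ = 0 := by
  simp only [Matrix.mul_apply]
  refine Finset.sum_eq_zero fun x₂ _ => ?_
  by_cases h2 : Qs x₂ y₂ = 0
  · rw [h2, mul_zero]
  · have h0 : ∑ x₁, Q y₁ x₁ * K x₁ x₂ = 0 := Finset.sum_eq_zero fun x₁ _ => by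
      by_cases h1 : Q y₁ x₁ = 0
      · rw [h1, zero_mul]
      · rw [h x₁ x₂ h1 h2, mul_zero]
    rw [h0, zero_mul]

omit [Fintype ι] [DecidableEq ι] [DecidableEq σ] [Fintype τ] [DecidableEq τ] [Fintype κ] [DecidableEq κ] in
/-- size of a sandwich kernel: `|(Q K Q^*)(y₁,y₂)| ≤ (Σ_x |Q(y₁,x)|)·B·(Σ_x |Q^*(x,y₂)|)` when `|K(x₁,x₂)| ≤ B` on the fine
sites averaged into `y₁`, `y₂`. [cite: BalabanImbrieJaffe1988, (5.7.11) p.293] -/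
theorem abs_sandwich_apply_le {Q : Matrix τ σ ℝ} {K : Matrix σ σ ℝ} {Qs : Matrix σ τ ℝ} {y₁ y₂ : τ} {B : ℝ}
    (h : ∀ x₁ x₂, Q y₁ x₁ ≠ 0 → Qs x₂ y₂ ≠ 0 → |K x₁ x₂| ≤ B) :
    |(Q * K * Qs) y₁ y₂| ≤ (∑ x₁, |Q y₁ x₁|) * B * ∑ x₂, |Qs x₂ y₂| := by
  simp only [Matrix.mul_apply]
  have hterm : ∀ x₁ x₂, |Q y₁ x₁ * K x₁ x₂ * Qs x₂ y₂| ≤ |Q y₁ x₁| * B * |Qs x₂ y₂| := by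
    intro x₁ x₂
    rw [abs_mul, abs_mul]
    by_cases h1 : Q y₁ x₁ = 0
    · rw [h1]; simp
    by_cases h2 : Qs x₂ y₂ = 0
    · rw [h2]; simp
    exact mul_le_mul_of_nonneg_right (mul_le_mul_of_nonneg_left (h x₁ x₂ h1 h2) (abs_nonneg _)) (abs_nonneg _)
  calc |∑ x₂, (∑ x₁, Q y₁ x₁ * K x₁ x₂) * Qs x₂ y₂|
      = |∑ x₂, ∑ x₁, Q y₁ x₁ * K x₁ x₂ * Qs x₂ y₂| := by simp_rw [Finset.sum_mul]
    _ ≤ ∑ x₂, ∑ x₁, |Q y₁ x₁ * K x₁ x₂ * Qs x₂ y₂| :=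
        (Finset.abs_sum_le_sum_abs _ _).trans (Finset.sum_le_sum fun x₂ _ => Finset.abs_sum_le_sum_abs _ _)
    _ ≤ ∑ x₂, ∑ x₁, |Q y₁ x₁| * B * |Qs x₂ y₂| :=
        Finset.sum_le_sum fun x₂ _ => Finset.sum_le_sum fun x₁ _ => hterm x₁ x₂
    _ = (∑ x₁, |Q y₁ x₁|) * B * ∑ x₂, |Qs x₂ y₂| := by
        rw [Finset.mul_sum]
        refine Finset.sum_congr rfl fun x₂ _ => ?_
        rw [Finset.sum_mul, Finset.sum_mul]

omit [Fintype ι] [DecidableEq ι] [DecidableEq σ] [Fintype τ] [DecidableEq τ] [Fintype κ] [DecidableEq κ] in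
/-- **support of a piece `a·Q G_X Q^*`, generic**: if `G_X(x₁,x₂) = 0` unless both fine sites are "in `X`" (`mem`), and the
coarse membership `cmem` is compatible with the supports of `Q`, `Q^*`, then `(a·Q G_X Q^*)(y₁,y₂) = 0` unless both coarse
sites are in `X`. [cite: BalabanImbrieJaffe1988, (5.7.11) p.293] -/
theorem delta_support_of {GX : Matrix σ σ ℝ} {mem : σ → Prop} (hGX : ∀ x₁ x₂, ¬ (mem x₁ ∧ mem x₂) → GX x₁ x₂ = 0)
    (Q : Matrix τ σ ℝ) (Qs : Matrix σ τ ℝ) (a : ℝ) {cmem : τ → Prop} (hQ : ∀ y x, Q y x ≠ 0 → mem x → cmem y)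
    (hQs : ∀ y x, Qs x y ≠ 0 → mem x → cmem y) {y₁ y₂ : τ} (hy : ¬ (cmem y₁ ∧ cmem y₂)) :
    (a • (Q * GX * Qs)) y₁ y₂ = 0 := by
  rw [Matrix.smul_apply, sandwich_apply_eq_zero fun x₁ x₂ h1 h2 => hGX x₁ x₂ fun hm =>
    hy ⟨hQ _ _ h1 hm.1, hQs _ _ h2 hm.2⟩, smul_zero]

omit [Fintype ι] [DecidableEq ι] [DecidableEq σ] [Fintype τ] [DecidableEq τ] [Fintype κ] [DecidableEq κ] in
/-- **size of a piece `a·Q G_X Q^*`, generic**: `|G_X| ≤ B` pointwise (`B ≥ 0`) and row/column `ℓ¹` sizes `q`, `q^*` of `Q`,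
`Q^*` give `|(a·Q G_X Q^*)(y₁,y₂)| ≤ |a|·q·q^*·B`. [cite: BalabanImbrieJaffe1988, (5.7.11) p.293] -/
theorem abs_delta_le_of {GX : Matrix σ σ ℝ} {B : ℝ} (hB : 0 ≤ B) (hGX : ∀ x₁ x₂, |GX x₁ x₂| ≤ B)
    (Q : Matrix τ σ ℝ) (Qs : Matrix σ τ ℝ) (a : ℝ) {q qs : ℝ} (hq : ∀ y, ∑ x, |Q y x| ≤ q)
    (hqs : ∀ y, ∑ x, |Qs x y| ≤ qs) (y₁ y₂ : τ) : |(a • (Q * GX * Qs)) y₁ y₂| ≤ |a| * q * qs * B := by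
  rw [Matrix.smul_apply, smul_eq_mul, abs_mul]
  have h1 : |(Q * GX * Qs) y₁ y₂| ≤ (∑ x, |Q y₁ x|) * B * ∑ x, |Qs x y₂| :=
    abs_sandwich_apply_le fun x₁ x₂ _ _ => hGX x₁ x₂
  have hq0 : 0 ≤ q := (Finset.sum_nonneg fun _ _ => abs_nonneg _).trans (hq y₁)
  have h2 : (∑ x, |Q y₁ x|) * B * ∑ x, |Qs x y₂| ≤ q * B * qs :=
    mul_le_mul (mul_le_mul_of_nonneg_right (hq y₁) hB) (hqs y₂) (Finset.sum_nonneg fun _ _ => abs_nonneg _)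
      (mul_nonneg hq0 hB)
  calc |a| * |(Q * GX * Qs) y₁ y₂| ≤ |a| * (q * B * qs) := mul_le_mul_of_nonneg_left (h1.trans h2) (abs_nonneg a)
    _ = |a| * q * qs * B := by ring

end Sandwich

/-! ## §2 The kernel form of *"C^{(j)}(u_{k+1})^{−1} = C^{(j)}(Λ̄₂^{(m)},u_{k+1})^{−1} + Σ_X Δ_j(X)"* -/

section Expansion

omit [Fintype ι] [DecidableEq ι] [DecidableEq σ] [Fintype τ] [Fintype κ] [DecidableEq κ] in
/-- **bookkeeping behind (5.7.11), rectangular kernels**: the inverse covariance `a·1 − a²·Q G_{loc} Q^* + P'` is AFFINE in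
the propagator, so a rewriting `G_{loc} = G + Mid − Σ_X G_X` of the propagator gives
`[a·1 − a²·Q G Q^* + P'] − a²·Q Mid Q^* + Σ_X a²·Q G_X Q^*` (the ring version, one carrier, is p36's
`BIJ88Resolvent5711.inv5711_expand`). [cite: BalabanImbrieJaffe1988, (5.7.11) p.293] -/
theorem inv_expand_kernel {ξ : Type*} (S : Finset ξ) {G Mid Gloc : Matrix σ σ ℝ} {GX : ξ → Matrix σ σ ℝ}
    (h : Gloc = G + Mid - ∑ X ∈ S, GX X) (Q : Matrix τ σ ℝ) (Qs : Matrix σ τ ℝ) (a : ℝ) (P' : Matrix τ τ ℝ) :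
    a • (1 : Matrix τ τ ℝ) - a ^ 2 • (Q * Gloc * Qs) + P' =
      (a • (1 : Matrix τ τ ℝ) - a ^ 2 • (Q * G * Qs) + P') - a ^ 2 • (Q * Mid * Qs)
        + ∑ X ∈ S, a ^ 2 • (Q * GX X * Qs) := by
  subst h
  rw [Matrix.mul_sub, Matrix.mul_add, Matrix.sub_mul, Matrix.add_mul, Matrix.mul_sum, Matrix.sum_mul, smul_sub,
    smul_add, Finset.smul_sum]
  abel

/-- the p. 293 rewriting of `G_{j,loc}(u_{k+1})` (sign corrected) as an identity of MATRICES on the fine sites, for [6]'s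
kernels under the hypotheses of `BIJ88RandomWalk578.hasSum_G` (region `Ω = Λ̄₂^{(m)}`): `G_{j,loc} = G + (G_{j,loc} − G_loc)
− Σ_X G_X`. [cite: BalabanImbrieJaffe1988, (5.7.11) p.293] -/
theorem display293_matrix (adj : ι → ι → Prop) [DecidableRel adj] {a b : ι → Matrix σ σ ℝ} {G : Matrix σ σ ℝ}
    {α β : ℝ} {D : ℕ} (hab : ∀ i l, ¬ adj i l → a i * b l = 0) (hbb : ∀ i l, ¬ adj i l → b i * b l = 0)
    (hα : ∀ i, ‖a i‖ ≤ α) (hβ : ∀ i, ‖b i‖ ≤ β) (hD : ∀ j, (Finset.univ.filter fun i => adj j i).card ≤ D)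
    (hDβ : (D : ℝ) * β < 1) (hR : ‖∑ i, b i‖ < 1) (hG : G * (1 - ∑ i, b i) = ∑ i, a i)
    (ldist : ι → σ → ℝ) (ρ : ℝ) (cubeOf : ι → κ) (cadj : κ → κ → Prop) (Gjloc : Matrix σ σ ℝ) :
    Gjloc = G + (Gjloc - Matrix.of (cLoc ldist ρ fun ω x₁ x₂ => walkTerm a b ω x₁ x₂)) -
      ∑ X, Matrix.of (cX ldist ρ cubeOf cadj (fun ω x₁ x₂ => walkTerm a b ω x₁ x₂) X) := by
  ext x₁ x₂
  rw [Matrix.sub_apply, Matrix.add_apply, Matrix.sub_apply, Matrix.of_apply, Matrix.sum_apply]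
  simp only [Matrix.of_apply]
  exact display293_G adj hab hbb hα hβ hD hDβ hR hG ldist ρ cubeOf cadj (fun x₁ x₂ => Gjloc x₁ x₂) x₁ x₂

omit [Fintype τ] in
/-- **THE KERNEL FORM OF *"C^{(j)}(u_{k+1})^{−1} = C^{(j)}(Λ̄₂^{(m)},u_{k+1})^{−1} + Σ_X Δ_j(X)"*, (5.7.11)** p. 293 — for
[6]'s kernels (hypotheses of `BIJ88RandomWalk578.hasSum_G` for `G = G_j(Λ̄₂^{(m)},u_{k+1})`), any kernel `G_{j,loc}` (the
print's `G_{j,loc}(u_{k+1})`), any averaging kernels `Q`, `Q^*`, constant `a_j` and term `P' = aL^{−2}P`: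
`a_j·1 − a_j²·Q G_{j,loc} Q^* + P' = [a_j·1 − a_j²·Q G Q^* + P'] − a_j²·Q (G_{j,loc} − G_loc) Q^* + Σ_X a_j²·Q G_X Q^*` with
the (5.7.8) parts `G_loc`, `G_X` of `G`; the bracket is the printed (5.7.11), the last sum the pieces `Δ_j(X)` (sign per
the corrected display, GAPS G-C2-p13-g7-1), the middle term the one *"we only need to look at in Λ̄₃^{(m)}"*
(`middle_apply_eq_zero`). [cite: BalabanImbrieJaffe1988, (5.7.11) p.293] -/
theorem inv5711_kernel (adj : ι → ι → Prop) [DecidableRel adj] {a b : ι → Matrix σ σ ℝ} {G : Matrix σ σ ℝ}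
    {α β : ℝ} {D : ℕ} (hab : ∀ i l, ¬ adj i l → a i * b l = 0) (hbb : ∀ i l, ¬ adj i l → b i * b l = 0)
    (hα : ∀ i, ‖a i‖ ≤ α) (hβ : ∀ i, ‖b i‖ ≤ β) (hD : ∀ j, (Finset.univ.filter fun i => adj j i).card ≤ D)
    (hDβ : (D : ℝ) * β < 1) (hR : ‖∑ i, b i‖ < 1) (hG : G * (1 - ∑ i, b i) = ∑ i, a i)
    (ldist : ι → σ → ℝ) (ρ : ℝ) (cubeOf : ι → κ) (cadj : κ → κ → Prop) (Gjloc : Matrix σ σ ℝ)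
    (Q : Matrix τ σ ℝ) (Qs : Matrix σ τ ℝ) (aj : ℝ) (P' : Matrix τ τ ℝ) :
    aj • (1 : Matrix τ τ ℝ) - aj ^ 2 • (Q * Gjloc * Qs) + P' =
      (aj • (1 : Matrix τ τ ℝ) - aj ^ 2 • (Q * G * Qs) + P')
        - aj ^ 2 • (Q * (Gjloc - Matrix.of (cLoc ldist ρ fun ω x₁ x₂ => walkTerm a b ω x₁ x₂)) * Qs)
        + ∑ X, aj ^ 2 • (Q * Matrix.of (cX ldist ρ cubeOf cadj (fun ω x₁ x₂ => walkTerm a b ω x₁ x₂) X) * Qs) :=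
  inv_expand_kernel Finset.univ (display293_matrix adj hab hbb hα hβ hD hDβ hR hG ldist ρ cubeOf cadj Gjloc) Q Qs aj P'

end Expansion

/-! ## §3 *"= 0 if x₁ or x₂ ∉ X"* — the support clause of (5.7.11) -/

section Support

omit [Fintype ι] [Fintype τ] [DecidableEq τ] in
/-- **SUPPORT CLAUSE of (5.7.11)** p. 293, verbatim *"|Δ_j(X, x₁, x₂)| … = 0 if x₁ or x₂ ∉ X"* — PROVED for
`Δ_j(X) = a_j²·Q G_j(Λ̄₂,X) Q^*` with [6]'s `G_j(Λ̄₂,X)` (`BIJ88RandomWalk578.gX_support`: the block supports of the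
letters): for every coarse membership `cmem` compatible with the supports of `Q`, `Q^*` (a fine site in a block inside
`X` is only averaged into coarse sites "in `X`"), `Δ_j(X)(y₁,y₂) = 0` unless `y₁` and `y₂` are in `X`.
[cite: BalabanImbrieJaffe1988, (5.7.11) p.293] -/
theorem delta_support (blk : σ → ι → Prop) {a b : ι → Matrix σ σ ℝ}
    (haR : ∀ j x, ¬ blk x j → ∀ z, a j x z = 0) (haC : ∀ j x, ¬ blk x j → ∀ z, a j z x = 0)
    (hbC : ∀ j x, ¬ blk x j → ∀ z, b j z x = 0)
    (ldist : ι → σ → ℝ) (ρ : ℝ) (cubeOf : ι → κ) (cadj : κ → κ → Prop)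
    (Q : Matrix τ σ ℝ) (Qs : Matrix σ τ ℝ) (aj : ℝ) (cmem : τ → Finset κ → Prop)
    (hQ : ∀ y x X, Q y x ≠ 0 → memX blk cubeOf cadj x X → cmem y X)
    (hQs : ∀ y x X, Qs x y ≠ 0 → memX blk cubeOf cadj x X → cmem y X)
    (X : Finset κ) {y₁ y₂ : τ} (hy : ¬ (cmem y₁ X ∧ cmem y₂ X)) :
    (aj ^ 2 • (Q * Matrix.of (cX ldist ρ cubeOf cadj (fun ω x₁ x₂ => walkTerm a b ω x₁ x₂) X) * Qs)) y₁ y₂ = 0 :=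
  delta_support_of (mem := fun x => memX blk cubeOf cadj x X)
    (fun x₁ x₂ hm => by
      rw [Matrix.of_apply]
      exact gX_support blk haR haC hbC ldist ρ cubeOf cadj X x₁ x₂ hm)
    Q Qs (aj ^ 2) (fun y x h hm => hQ y x X h hm) (fun y x h hm => hQs y x X h hm) hy

end Support

/-! ## §4 *"|Δ_j(X, x₁, x₂)| ≦ e^{−cr(e_j)|X|}"* — the bound of (5.7.11) -/

section Bound

omit [Fintype τ] [DecidableEq τ] in
/-- **THE BOUND of (5.7.11)** p. 293, verbatim *"|Δ_j(X, x₁, x₂)| ≦ e^{−cr(e_j)|X|}"* — PROVED for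
`Δ_j(X) = a_j²·Q G_j(Λ̄₂,X) Q^*` with the constant displayed: `|Δ_j(X)(y₁,y₂)| ≤ a_j²·q·q^*·exp(−(δ/(32K²M))·rek·|X|)`,
where `q`, `q^*` bound the row sums of `|Q|` and the column sums of `|Q^*|`, and the exponential is the (5.7.8) factor of
`BIJ88RandomWalk578.abs_gX_le` for [6]'s kernels (its hypotheses verbatim: letters `‖a_i‖ ≤ α`, `‖b_i‖ ≤ β`, locality
`adj`, block supports, label metric `d`, cube geometry `touch`/`K`/`s`, `μ`, `b₀`, `s/8 ≤ (ρ − b₀)/μ`, `Dβ ≤ e^{−δ}`,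
`rek ≤ M·s`, largeness `s₀α/(1 − Dβ) ≤ exp(δs/(32K²))`; `|X|` = number of cubes).
[cite: BalabanImbrieJaffe1988, (5.7.11) p.293] -/
theorem abs_delta_le (adj : ι → ι → Prop) [DecidableRel adj] (blk : σ → ι → Prop) {a b : ι → Matrix σ σ ℝ}
    {α β : ℝ} (hab : ∀ i l, ¬ adj i l → a i * b l = 0) (hbb : ∀ i l, ¬ adj i l → b i * b l = 0)
    (hα0 : 0 ≤ α) (hα : ∀ i, ‖a i‖ ≤ α) (hβ0 : 0 ≤ β) (hβ : ∀ i, ‖b i‖ ≤ β)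
    (haR : ∀ j x, ¬ blk x j → ∀ z, a j x z = 0) (haC : ∀ j x, ¬ blk x j → ∀ z, a j z x = 0)
    (hbC : ∀ j x, ¬ blk x j → ∀ z, b j z x = 0)
    (ldist : ι → σ → ℝ) (ρ : ℝ) (cubeOf : ι → κ) (cadj : κ → κ → Prop) [DecidableRel cadj]
    (d : ι → ι → ℝ) (hd0 : ∀ i, d i i = 0) (hdsymm : ∀ i l, d i l = d l i)
    (htri : ∀ i j l, d i l ≤ d i j + d j l) (hadj : ∀ i l, adj i l → d i l ≤ 1)
    (touch : κ → κ → Prop) [DecidableRel touch] (hrefl : ∀ c, touch c c)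
    (htsymm : ∀ c c', touch c c' → touch c' c) {K : ℕ}
    (hK : ∀ (c : κ) (Y : Finset κ), (Y.filter fun c' => touch c c').card ≤ K)
    (hKc : ∀ c : κ, (Finset.univ.filter fun c' => c = c' ∨ cadj c c').card ≤ K)
    {s : ℕ} (hfar : ∀ i l, ¬ touch (cubeOf i) (cubeOf l) → (s : ℝ) ≤ d i l)
    {μ b₀ : ℝ} (hμ : 0 < μ) (hld : ∀ (i l : ι) (x : σ), ldist l x ≤ ldist i x + μ * d i l)
    (hb : ∀ (x : σ) (i : ι), blk x i → ldist i x ≤ b₀) (hρ : (s : ℝ) / 8 ≤ (ρ - b₀) / μ)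
    {δ : ℝ} {D s₀ : ℕ} (hD : ∀ j, (Finset.univ.filter fun i => adj j i).card ≤ D) (hδ : 0 < δ)
    (hθ : (D : ℝ) * β ≤ Real.exp (-δ))
    (hS₀ : ∀ x, ∃ S₀ : Finset ι, S₀.card ≤ s₀ ∧ ∀ i, blk x i → i ∈ S₀)
    {M rek : ℝ} (hM : 0 < M) (hs : rek ≤ M * s)
    (hlarge : s₀ * α / (1 - D * β) ≤ Real.exp (δ * s / (32 * K * K)))
    (Q : Matrix τ σ ℝ) (Qs : Matrix σ τ ℝ) (aj : ℝ) {q qs : ℝ} (hq : ∀ y, ∑ x, |Q y x| ≤ q)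
    (hqs : ∀ y, ∑ x, |Qs x y| ≤ qs) (X : Finset κ) (y₁ y₂ : τ) :
    |(aj ^ 2 • (Q * Matrix.of (cX ldist ρ cubeOf cadj (fun ω x₁ x₂ => walkTerm a b ω x₁ x₂) X) * Qs)) y₁ y₂| ≤
      aj ^ 2 * q * qs * Real.exp (-(δ / (32 * K * K * M)) * rek * (X.card : ℕ)) := by
  have hB := abs_gX_le adj blk hab hbb hα0 hα hβ0 hβ haR haC hbC ldist ρ cubeOf cadj d hd0 hdsymm htri hadj touch
    hrefl htsymm hK hKc hfar hμ hld hb hρ hD hδ hθ hS₀ hM hs hlarge X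
  have h := abs_delta_le_of (GX := Matrix.of (cX ldist ρ cubeOf cadj (fun ω x₁ x₂ => walkTerm a b ω x₁ x₂) X))
    (Real.exp_nonneg _) (fun x₁ x₂ => hB x₁ x₂) Q Qs (aj ^ 2) hq hqs y₁ y₂
  rwa [abs_of_nonneg (sq_nonneg aj)] at h

omit [Fintype τ] [DecidableEq τ] in
/-- **THE BOUND of (5.7.11) IN THE PRINTED, CONSTANT-FREE FORM** *"|Δ_j(X, x₁, x₂)| ≦ e^{−cr(e_j)|X|}"*: with
`c := (δ/(32K²M))·rek ≥ 0` and the prefactor absorbed for `r(e_j)` large (`a_j²qq^* ≤ e^{c/2}`),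
`|Δ_j(X)(y₁,y₂)| ≤ exp(−(c/2)·|X|)` for EVERY cube set `X` (`X = ∅`: the piece vanishes, `BIJ88Ineq246Walks.cX_empty`;
`|X| ≥ 1`: half of the rate absorbs the prefactor). [cite: BalabanImbrieJaffe1988, (5.7.11) p.293] -/
theorem abs_delta_le_printed (adj : ι → ι → Prop) [DecidableRel adj] (blk : σ → ι → Prop) {a b : ι → Matrix σ σ ℝ}
    {α β : ℝ} (hab : ∀ i l, ¬ adj i l → a i * b l = 0) (hbb : ∀ i l, ¬ adj i l → b i * b l = 0)
    (hα0 : 0 ≤ α) (hα : ∀ i, ‖a i‖ ≤ α) (hβ0 : 0 ≤ β) (hβ : ∀ i, ‖b i‖ ≤ β)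
    (haR : ∀ j x, ¬ blk x j → ∀ z, a j x z = 0) (haC : ∀ j x, ¬ blk x j → ∀ z, a j z x = 0)
    (hbC : ∀ j x, ¬ blk x j → ∀ z, b j z x = 0)
    (ldist : ι → σ → ℝ) (ρ : ℝ) (cubeOf : ι → κ) (cadj : κ → κ → Prop) [DecidableRel cadj]
    (d : ι → ι → ℝ) (hd0 : ∀ i, d i i = 0) (hdsymm : ∀ i l, d i l = d l i)
    (htri : ∀ i j l, d i l ≤ d i j + d j l) (hadj : ∀ i l, adj i l → d i l ≤ 1)
    (touch : κ → κ → Prop) [DecidableRel touch] (hrefl : ∀ c, touch c c)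
    (htsymm : ∀ c c', touch c c' → touch c' c) {K : ℕ}
    (hK : ∀ (c : κ) (Y : Finset κ), (Y.filter fun c' => touch c c').card ≤ K)
    (hKc : ∀ c : κ, (Finset.univ.filter fun c' => c = c' ∨ cadj c c').card ≤ K)
    {s : ℕ} (hfar : ∀ i l, ¬ touch (cubeOf i) (cubeOf l) → (s : ℝ) ≤ d i l)
    {μ b₀ : ℝ} (hμ : 0 < μ) (hld : ∀ (i l : ι) (x : σ), ldist l x ≤ ldist i x + μ * d i l)
    (hb : ∀ (x : σ) (i : ι), blk x i → ldist i x ≤ b₀) (hρ : (s : ℝ) / 8 ≤ (ρ - b₀) / μ)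
    {δ : ℝ} {D s₀ : ℕ} (hD : ∀ j, (Finset.univ.filter fun i => adj j i).card ≤ D) (hδ : 0 < δ)
    (hθ : (D : ℝ) * β ≤ Real.exp (-δ))
    (hS₀ : ∀ x, ∃ S₀ : Finset ι, S₀.card ≤ s₀ ∧ ∀ i, blk x i → i ∈ S₀)
    {M rek : ℝ} (hM : 0 < M) (hrek : 0 ≤ rek) (hs : rek ≤ M * s)
    (hlarge : s₀ * α / (1 - D * β) ≤ Real.exp (δ * s / (32 * K * K)))
    (Q : Matrix τ σ ℝ) (Qs : Matrix σ τ ℝ) (aj : ℝ) {q qs : ℝ} (hq : ∀ y, ∑ x, |Q y x| ≤ q)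
    (hqs : ∀ y, ∑ x, |Qs x y| ≤ qs)
    (hconst : aj ^ 2 * q * qs ≤ Real.exp (δ / (32 * K * K * M) * rek / 2)) (X : Finset κ) (y₁ y₂ : τ) :
    |(aj ^ 2 • (Q * Matrix.of (cX ldist ρ cubeOf cadj (fun ω x₁ x₂ => walkTerm a b ω x₁ x₂) X) * Qs)) y₁ y₂| ≤
      Real.exp (-(δ / (32 * K * K * M) * rek / 2) * (X.card : ℕ)) := by
  by_cases hX : X = ∅
  · subst hX
    rw [Matrix.smul_apply, sandwich_apply_eq_zero fun x₁ x₂ _ _ => by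
      rw [Matrix.of_apply]; exact BIJ88Ineq246Walks.cX_empty ldist ρ cubeOf cadj _ x₁ x₂, smul_zero, abs_zero]
    exact Real.exp_nonneg _
  have h := abs_delta_le adj blk hab hbb hα0 hα hβ0 hβ haR haC hbC ldist ρ cubeOf cadj d hd0 hdsymm htri hadj touch
    hrefl htsymm hK hKc hfar hμ hld hb hρ hD hδ hθ hS₀ hM hs hlarge Q Qs aj hq hqs X y₁ y₂
  have hcard : (1 : ℝ) ≤ ((X.card : ℕ) : ℝ) := by
    exact_mod_cast Finset.one_le_card.mpr (Finset.nonempty_iff_ne_empty.mpr hX)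
  have hc : 0 ≤ δ / (32 * K * K * M) * rek / 2 := by positivity
  refine h.trans ?_
  calc aj ^ 2 * q * qs * Real.exp (-(δ / (32 * K * K * M)) * rek * (X.card : ℕ))
      ≤ Real.exp (δ / (32 * K * K * M) * rek / 2) * Real.exp (-(δ / (32 * K * K * M)) * rek * (X.card : ℕ)) :=
        mul_le_mul_of_nonneg_right hconst (Real.exp_nonneg _)
    _ = Real.exp (δ / (32 * K * K * M) * rek / 2 + -(δ / (32 * K * K * M)) * rek * (X.card : ℕ)) :=
        (Real.exp_add _ _).symm
    _ ≤ Real.exp (-(δ / (32 * K * K * M) * rek / 2) * (X.card : ℕ)) := by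
        refine Real.exp_le_exp.mpr ?_
        nlinarith

end Bound

/-! ## §5 *"We only need to look at this operator in Λ̄₃^{(m)}"* — the middle term -/

section Middle

omit [Fintype ι] [Fintype τ] [DecidableEq τ] [Fintype κ] [DecidableEq κ] in
/-- **"We only need to look at this operator in Λ̄₃^{(m)}"** p. 293 — the middle term
`a·Q (G_{j,loc}(u) − G_{j,loc}(Λ̄₂,u)) Q^*` of the p. 293 rewriting, for [6]'s local parts built from two letter families
`(a, b)` (whole lattice) and `(a', b')` (region `Λ̄₂^{(m)}`), VANISHES at `(y₁,y₂)` as soon as the two families coincide at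
every label within `ρ` of each fine site averaged into `y₁` and of each fine site averaged into `y₂`
(`BIJ88RandomWalk578.gLoc_congr`: *"G_{j,loc} is independent of Ω"* far from `Ω^c`).  In the `ρ`-neighbourhood model
of `G_{j,loc}` this is the case for `y₁ ∈ Λ̄₃^{(m)}` once `dist(Λ̄₃^{(m)}, Λ̄₂^{(m)c}) > ρ + O(M)`; the print's cube
model gives a factor `e^{−cr(e_j)}` there instead (not reproduced). [cite: BalabanImbrieJaffe1988, (5.7.11) p.293] -/
theorem middle_apply_eq_zero {a b a' b' : ι → Matrix σ σ ℝ} (ldist : ι → σ → ℝ) (ρ : ℝ)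
    (Q : Matrix τ σ ℝ) (Qs : Matrix σ τ ℝ) (c : ℝ) {y₁ y₂ : τ}
    (hagree : ∀ x₁ x₂, Q y₁ x₁ ≠ 0 → Qs x₂ y₂ ≠ 0 →
      ∀ j, ldist j x₁ ≤ ρ → ldist j x₂ ≤ ρ → a j = a' j ∧ b j = b' j) :
    (c • (Q * (Matrix.of (cLoc ldist ρ fun ω x₁ x₂ => walkTerm a b ω x₁ x₂) -
        Matrix.of (cLoc ldist ρ fun ω x₁ x₂ => walkTerm a' b' ω x₁ x₂)) * Qs)) y₁ y₂ = 0 := by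
  rw [Matrix.smul_apply, sandwich_apply_eq_zero fun x₁ x₂ h1 h2 => ?_, smul_zero]
  rw [Matrix.sub_apply, Matrix.of_apply, Matrix.of_apply, sub_eq_zero]
  exact gLoc_congr ldist ρ (fun j hj1 hj2 => (hagree x₁ x₂ h1 h2 j hj1 hj2).1)
    fun j hj1 hj2 => (hagree x₁ x₂ h1 h2 j hj1 hj2).2

omit [Fintype τ] in
/-- consequence for the expansion: at such coarse points the inverse covariance of `G_{j,loc}(u)` and that of (5.7.11)
differ EXACTLY by the pieces, `[a_j·1 − a_j²·Q G_{j,loc}(u) Q^* + P'](y₁,y₂) = [a_j·1 − a_j²·Q G Q^* + P'](y₁,y₂) +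
Σ_X Δ_j(X)(y₁,y₂)` — the printed *"C^{(j)}(u_{k+1})^{−1} = C^{(j)}(Λ̄₂^{(m)},u_{k+1})^{−1} + Σ_X Δ_j(X)"* read in `Λ̄₃^{(m)}`,
for [6]'s kernels: `G_{j,loc}(u) = cLoc` of the whole-lattice letters `(a, b)`, `G`, `G_loc`, `G_X` those of the region's
letters `(a', b')` under the hypotheses of `BIJ88RandomWalk578.hasSum_G`. [cite: BalabanImbrieJaffe1988, (5.7.11) p.293] -/
theorem inv5711_apply_of_deep (adj : ι → ι → Prop) [DecidableRel adj] {a b a' b' : ι → Matrix σ σ ℝ}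
    {G : Matrix σ σ ℝ} {α β : ℝ} {D : ℕ} (hab : ∀ i l, ¬ adj i l → a' i * b' l = 0)
    (hbb : ∀ i l, ¬ adj i l → b' i * b' l = 0) (hα : ∀ i, ‖a' i‖ ≤ α) (hβ : ∀ i, ‖b' i‖ ≤ β)
    (hD : ∀ j, (Finset.univ.filter fun i => adj j i).card ≤ D) (hDβ : (D : ℝ) * β < 1) (hR : ‖∑ i, b' i‖ < 1)
    (hG : G * (1 - ∑ i, b' i) = ∑ i, a' i) (ldist : ι → σ → ℝ) (ρ : ℝ) (cubeOf : ι → κ) (cadj : κ → κ → Prop)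
    (Q : Matrix τ σ ℝ) (Qs : Matrix σ τ ℝ) (aj : ℝ) (P' : Matrix τ τ ℝ) {y₁ y₂ : τ}
    (hagree : ∀ x₁ x₂, Q y₁ x₁ ≠ 0 → Qs x₂ y₂ ≠ 0 →
      ∀ j, ldist j x₁ ≤ ρ → ldist j x₂ ≤ ρ → a j = a' j ∧ b j = b' j) :
    (aj • (1 : Matrix τ τ ℝ) - aj ^ 2 • (Q * Matrix.of (cLoc ldist ρ fun ω x₁ x₂ => walkTerm a b ω x₁ x₂) * Qs) + P')
        y₁ y₂ =
      (aj • (1 : Matrix τ τ ℝ) - aj ^ 2 • (Q * G * Qs) + P') y₁ y₂ +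
        ∑ X, (aj ^ 2 • (Q * Matrix.of (cX ldist ρ cubeOf cadj (fun ω x₁ x₂ => walkTerm a' b' ω x₁ x₂) X) * Qs))
          y₁ y₂ := by
  have h := inv5711_kernel adj hab hbb hα hβ hD hDβ hR hG ldist ρ cubeOf cadj
    (Matrix.of (cLoc ldist ρ fun ω x₁ x₂ => walkTerm a b ω x₁ x₂)) Q Qs aj P'
  have hmid := middle_apply_eq_zero (a := a) (b := b) (a' := a') (b' := b') ldist ρ Q Qs (aj ^ 2) hagree
  have h' := congrFun (congrFun h y₁) y₂
  simp only [Matrix.add_apply, Matrix.sub_apply, Matrix.sum_apply] at h' ⊢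
  rw [hmid, sub_zero] at h'
  exact h'

end Middle

end Literature.MathematicalPhysics.QuantumFieldTheory.BalabanImbrieJaffe1984to88.BIJ88Delta5711
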